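import Summits.ResolutionOfSingularities.ResolutionOfSingularities.Theorems.FrobeniusClosingPatchingRelPerfectCoreRungTowerHypersurface
import Literature.AlgebraicGeometry.Resolution.BlowupAlgebraStrictTransform
import HarnessLib

/-!
# Crux `PatchingRelPerfect` (stmt-ResolutionOfSingularities-16161), chain w52 — rung toolkit:
# the STRICT TRANSFORM OF THE OLD EXCEPTIONAL DIVISOR on the charts of a point blow-up

[OURS · L1 W5.2 · rung tool] In every tower of the core's format the second blowing up has centre
inside the first exceptional divisor `E = V(t)`, and on the Rees charts `C_j` of that blowing up
(`c = (t, v₁, …, v_m)`, chart of `v_k`, exceptional parameter `w = v_k/1`) the strict transform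
of `E` is cut out by the chart generator `u' = e'₀ = t/v_k` (`φ(t) = w u'`).  Centres of the NEXT
step lying in that strict transform are pairs `(u', g)` whose first member is NOT the exceptional
parameter of the chart, so the chart-family lemmas (`chartQuotEquiv`, `chartStageEquiv`) do not
apply.  This file supplies what the regular-centre tower (`isRegular_of_isBlowup_tower`) needs for
such pairs, over an arbitrary domain `A` with `c` quasi-regular, `A/(c)` and `A/(t)` domains and
`v_k ∉ (t)`:

* `ConeRung.strictExc_isDomain_quot` — **`C_j ⧸ (u')` is a domain**: through Stacks 0804
  `C_j ≅ A[(c)/v_k]` (`reesChartEquiv`) and the hypersurface case of Görtz–Wedhorn 13.96 (2)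
  (`blowupAlgebra.quotientKerMapQuotientEquiv`: `A[(c)/v_k] ⧸ (u') ≅ (A/(t))[(c̄)/v̄_k]`, the chart
  ring of the blowing up of the DOMAIN `A/(t)`, inside `(A/(t))[1/v̄_k]`), the inputs being
  `w` prime in `C_j` (`C_j/(w)` is a polynomial ring over `A/(c)`) and `w ∤ u'` (`u'` is a variable
  modulo `w`);
* `ConeRung.strictExc_notMem_of_chartBase_eq` — **`g ∉ (u')` whenever `φ(r) = wⁿ g` with
  `r ∉ (t)`** (the image of `r̄ ≠ 0` in `(A/(t))[1/v̄_k]` is non-zero);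
* `ConeRung.strictExc_isWeaklyRegular_pair`, `ConeRung.strictExc_isQuasiRegular_pair` — hence
  `(u', g)` is a weakly regular, so quasi-regular, pair on `C_j` (stub-1's
  `CoreRungTower.isWeaklyRegular_pair_of_notMem`, Matsumura 16.2 (i)).

Arbitrary commutative rings; nothing here is a statement of the manuscript under review.

## References

* The Stacks Project, Tags 0804, 07Z3, 0BIQ. [StacksProject]
* U. Görtz, T. Wedhorn, *Algebraic Geometry I*, 2nd ed. 2020, Prop. 13.96 (2), p. 416.
  [GortzWedhorn2020]
* H. Matsumura, *Commutative Ring Theory*, CUP 1986, Thm. 16.2 (i). [Matsumura1987]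
-/

-- `Summit.<Summit>.<Sub>.Theorems` with `Sub = Summit` (single-conjunct summit, D-0017)
set_option linter.dupNamespace false

noncomputable section

open CategoryTheory CategoryTheory.Limits AlgebraicGeometry Literature.AlgebraicGeometry.Resolution
open IsLocalRing

namespace Summit.ResolutionOfSingularities.ResolutionOfSingularities.Theorems

namespace ConeRung

universe u

section StrictExceptional

variable {A : Type u} [CommRing A] {m : ℕ} (t : A) (v : Fin m → A) (k : Fin m)

local notation3 "cc" => (Fin.cons t v : Fin (m + 1) → A)
local notation3 "II" => Ideal.span (Set.range (Fin.cons t v : Fin (m + 1) → A))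
/-- the `v_k`-chart `C` of `Bl_{(c)} Spec A`, its structure map, exceptional parameter `w` and the
strict transform `u' = e'₀` of `t` -/
local notation3 "C" => chartRing cc (Fin.succ k)
local notation3 "ψ" => chartBase cc (Fin.succ k)
local notation3 "w" => chartBase cc (Fin.succ k) (cc (Fin.succ k))
local notation3 "u'" => chartGen cc (Fin.succ k) 0
/-- the affine blowup algebra model `A[(c)/v_k] ⊆ A[1/v_k]` and the comparison isomorphism -/
local notation3 "RR" => blowupAlgebra (Ideal.span (Set.range (Fin.cons t v : Fin (m + 1) → A)))
  ((Fin.cons t v : Fin (m + 1) → A) (Fin.succ k))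
local notation3 "Φ" => reesChartEquiv (I := Ideal.span (Set.range (Fin.cons t v : Fin (m + 1) → A)))
  ((Fin.cons t v : Fin (m + 1) → A) (Fin.succ k))
  (Ideal.mem_span_range_self (f := (Fin.cons t v : Fin (m + 1) → A)) (x := Fin.succ k))

/-- `φ(t) = w · u'` on the `v_k`-chart. [cite: StacksProject, Tag 0804] -/
theorem strictExc_chartBase_t : ψ t = w * u' :=
  reesChartBase_apply_eq_mul_chartGen cc (Fin.succ k) 0

/-- The comparison isomorphism on the structure map: `Φ (φ r) = r` in `A[(c)/v_k]`.
[cite: StacksProject, Tag 0804] -/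
theorem strictExc_equiv_chartBase (r : A) : Φ (ψ r) = algebraMap A RR r :=
  reesChartEquiv_reesChartBase _ _ r

/-- **The strict-transform factorisation in `A[(c)/v_k]`**: `t = v_k¹ · Φ(u')`. [folklore] -/
theorem strictExc_factor :
    algebraMap A RR t = algebraMap A RR (cc (Fin.succ k)) ^ 1 * Φ u' := by
  rw [pow_one, ← strictExc_equiv_chartBase t v k t, strictExc_chartBase_t, map_mul,
    strictExc_equiv_chartBase]

/-- `u' ∉ (w)`: modulo `w` the generator `u'` is the variable `T₀` of the polynomial ring
`C/(w) ≅ (A/(c))[T_j : j ≠ k+1]`. [cite: StacksProject, Tag 0BIQ] -/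
theorem strictExc_chartGen_notMem_span (hc : IsQuasiRegular cc) [Nontrivial (A ⧸ II)] :
    u' ∉ Ideal.span {w} := by
  intro h
  have hX : chartQuotEquiv cc (Fin.succ k) hc (MvPolynomial.X ⟨0, (Fin.succ_ne_zero k).symm⟩) =
      Ideal.Quotient.mk (Ideal.span {w}) u' := by
    rw [chartQuotEquiv_apply, chartQuotMap_X]
  rw [Ideal.Quotient.eq_zero_iff_mem.mpr h, map_eq_zero_iff _ (chartQuotEquiv cc _ hc).injective]
    at hX
  exact MvPolynomial.X_ne_zero _ hX

/-- The chart ring is non-trivial when `A/(c)` is. [folklore] -/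
theorem strictExc_nontrivial (hc : IsQuasiRegular cc) [Nontrivial (A ⧸ II)] : Nontrivial C := by
  haveI : Nontrivial (C ⧸ Ideal.span {w}) :=
    Function.Surjective.nontrivial (f := (chartQuotEquiv cc (Fin.succ k) hc).symm)
      (chartQuotEquiv cc (Fin.succ k) hc).symm.surjective
  exact Function.Surjective.nontrivial (f := Ideal.Quotient.mk (Ideal.span {w}))
    Ideal.Quotient.mk_surjective

/-- The chart ring is a domain when `A` is (`C ≅ A[(c)/v_k] ⊆ A[1/v_k]`, `v_k ≠ 0`).
[cite: StacksProject, Tag 0804] -/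
theorem strictExc_isDomain_chart [IsDomain A] (hvk0 : cc (Fin.succ k) ≠ 0) : IsDomain C := by
  haveI : IsDomain (Localization.Away (cc (Fin.succ k))) :=
    IsLocalization.isDomain_localization (powers_le_nonZeroDivisors_of_noZeroDivisors hvk0)
  exact MulEquiv.isDomain RR (Φ).toMulEquiv

/-- `v_k` is a prime element of `A[(c)/v_k]` when `A/(c)` is a domain: `A[(c)/v_k]/(v_k) ≅ C/(w)`
is a polynomial ring over `A/(c)`. [cite: StacksProject, Tag 0BIQ] -/
theorem strictExc_prime_algebraMap (hc : IsQuasiRegular cc) [IsDomain (A ⧸ II)] :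
    Prime (algebraMap A RR (cc (Fin.succ k))) := by
  haveI : IsDomain (C ⧸ Ideal.span {w}) := isDomain_chartRing_quot_span cc (Fin.succ k) hc
  have e1 : (C ⧸ Ideal.span {w}) ≃+* (RR ⧸ Ideal.span {algebraMap A RR (cc (Fin.succ k))}) :=
    Ideal.quotientEquiv _ _ (Φ) (by
      rw [Ideal.map_span, Set.image_singleton]
      exact congrArg (fun y => Ideal.span {y}) (strictExc_equiv_chartBase t v k _).symm)
  haveI : IsDomain (RR ⧸ Ideal.span {algebraMap A RR (cc (Fin.succ k))}) :=
    MulEquiv.isDomain (C ⧸ Ideal.span {w}) e1.symm.toMulEquiv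
  haveI : Nontrivial RR :=
    Function.Surjective.nontrivial
      (f := Ideal.Quotient.mk (Ideal.span {algebraMap A RR (cc (Fin.succ k))}))
      Ideal.Quotient.mk_surjective
  have ha0 : algebraMap A RR (cc (Fin.succ k)) ≠ 0 :=
    nonZeroDivisors.ne_zero algebraMap_mem_nonZeroDivisors_blowupAlgebra
  exact (Ideal.span_singleton_prime ha0).mp ((Ideal.Quotient.isDomain_iff_prime _).mp ‹_›)

/-- `v_k ∤ Φ(u')` in `A[(c)/v_k]`. [folklore] -/
theorem strictExc_not_dvd (hc : IsQuasiRegular cc) [IsDomain (A ⧸ II)] :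
    ¬ algebraMap A RR (cc (Fin.succ k)) ∣ Φ u' := by
  rintro ⟨y, hy⟩
  apply strictExc_chartGen_notMem_span t v k hc
  rw [Ideal.mem_span_singleton]
  refine ⟨(Φ).symm y, (Φ).injective ?_⟩
  rw [map_mul, RingEquiv.apply_symm_apply, strictExc_equiv_chartBase, ← hy]

/-- `v̄_k ≠ 0` in `A/(t)`. [folklore] -/
theorem strictExc_mk_ne_zero (hvk : v k ∉ Ideal.span {t}) :
    Ideal.Quotient.mk (Ideal.span {t}) (cc (Fin.succ k)) ≠ 0 := by
  rw [Fin.cons_succ, Ne, Ideal.Quotient.eq_zero_iff_mem]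
  exact hvk

/-- The target `(A/(t))[(c̄)/v̄_k] ⊆ (A/(t))[1/v̄_k]` is a domain when `A/(t)` is and `v_k ∉ (t)`.
[folklore] -/
theorem strictExc_isDomain_target [IsDomain (A ⧸ Ideal.span {t})] (hvk : v k ∉ Ideal.span {t}) :
    IsDomain (blowupAlgebra ((II).map (Ideal.Quotient.mk (Ideal.span {t})))
      (Ideal.Quotient.mk (Ideal.span {t}) (cc (Fin.succ k)))) := by
  haveI : IsDomain (Localization.Away (Ideal.Quotient.mk (Ideal.span {t}) (cc (Fin.succ k)))) :=
    IsLocalization.isDomain_localization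
      (powers_le_nonZeroDivisors_of_noZeroDivisors (strictExc_mk_ne_zero t v k hvk))
  infer_instance

/-- **The strict transform of the old exceptional divisor is a domain chart by chart**:
`C ⧸ (u')` is a domain (`≅ (A/(t))[(c̄)/v̄_k]`, Görtz–Wedhorn 13.96 (2) for the hypersurface
`V(t)`). [cite: GortzWedhorn2020, Prop. 13.96 (2) and p. 416] [cite: StacksProject, Tag 0804] -/
theorem strictExc_isDomain_quot (hc : IsQuasiRegular cc) [IsDomain (A ⧸ II)]
    [IsDomain (A ⧸ Ideal.span {t})] (hvk : v k ∉ Ideal.span {t}) :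
    IsDomain (C ⧸ Ideal.span {u'}) := by
  haveI := strictExc_isDomain_target t v k hvk
  let e := blowupAlgebra.quotientKerMapQuotientEquiv (II) (cc (Fin.succ k))
    (strictExc_factor t v k) (strictExc_prime_algebraMap t v k hc) (strictExc_not_dvd t v k hc)
  have e1 : (C ⧸ Ideal.span {u'}) ≃+* (RR ⧸ Ideal.span {Φ u'}) :=
    Ideal.quotientEquiv _ _ (Φ) (by rw [Ideal.map_span, Set.image_singleton]; rfl)
  exact MulEquiv.isDomain _ (e1.trans e).toMulEquiv

/-- **Non-membership criterion**: if `φ(r) = wⁿ · g` with `r ∉ (t)`, then `g ∉ (u')` — the image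
of `g` in the domain `(A/(t))[(c̄)/v̄_k] ⊆ (A/(t))[1/v̄_k]` is `r̄ / v̄_kⁿ ≠ 0`. [folklore] -/
theorem strictExc_notMem_of_chartBase_eq (hc : IsQuasiRegular cc) [IsDomain (A ⧸ II)]
    [IsDomain (A ⧸ Ideal.span {t})] (hvk : v k ∉ Ideal.span {t}) {g : C} {r : A} {n : ℕ}
    (h : ψ r = w ^ n * g) (hr : r ∉ Ideal.span {t}) : g ∉ Ideal.span {u'} := by
  intro hg
  have hker := blowupAlgebra.ker_mapQuotient_eq_span (II) (cc (Fin.succ k))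
    (strictExc_factor t v k) (strictExc_prime_algebraMap t v k hc) (strictExc_not_dvd t v k hc)
  set θ := blowupAlgebra.mapQuotient (II) (cc (Fin.succ k)) (Ideal.span {t}) with hθ
  have h1 : θ (Φ g) = 0 := by
    rw [← RingHom.mem_ker, hker, Ideal.mem_span_singleton]
    obtain ⟨y, hy⟩ := Ideal.mem_span_singleton.mp hg
    exact ⟨Φ y, by rw [hy, map_mul]⟩
  have h2 : θ (algebraMap A RR r) = 0 := by
    rw [← strictExc_equiv_chartBase t v k r, h, map_mul, map_mul, h1, mul_zero]
  rw [hθ, blowupAlgebra.mapQuotient_algebraMap] at h2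
  have h3 : algebraMap (A ⧸ Ideal.span {t})
      (Localization.Away (Ideal.Quotient.mk (Ideal.span {t}) (cc (Fin.succ k))))
      (Ideal.Quotient.mk (Ideal.span {t}) r) = 0 := by
    have h4 := congrArg Subtype.val h2
    rwa [Subalgebra.coe_algebraMap, ZeroMemClass.coe_zero] at h4
  have hinj := IsLocalization.injective
    (Localization.Away (Ideal.Quotient.mk (Ideal.span {t}) (cc (Fin.succ k))))
    (powers_le_nonZeroDivisors_of_noZeroDivisors (strictExc_mk_ne_zero t v k hvk))
  exact hr (Ideal.Quotient.eq_zero_iff_mem.mp (hinj (by rw [h3, map_zero])))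

/-- `v_k ≠ 0`. [folklore] -/
theorem strictExc_ne_zero (hvk : v k ∉ Ideal.span {t}) : cc (Fin.succ k) ≠ 0 := by
  rw [Fin.cons_succ]
  exact fun h => hvk (h ▸ Ideal.zero_mem _)

/-- **A weakly regular pair read through a ring isomorphism onto a domain**: if `e : X ≅ Y`
with `Y` a domain, `e(a) ≠ 0`, `X/(a)` is a domain and `g ∉ (a)`, then `(a, g)` is a weakly regular
sequence on `X` (stub-1's `CoreRungTower.isWeaklyRegular_pair_of_notMem`). [folklore] -/
theorem isWeaklyRegular_pair_of_equiv {X Y : Type*} [CommRing X] [CommRing Y] [IsDomain Y]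
    (e : X ≃+* Y) {a g : X} (ha : e a ≠ 0) [IsDomain (X ⧸ Ideal.span {a})]
    (hg : g ∉ Ideal.span {a}) :
    RingTheory.Sequence.IsWeaklyRegular X (List.ofFn (Fin.cons a fun _ : Fin 1 => g)) :=
  CoreRungTower.isWeaklyRegular_pair_of_notMem
    (mem_nonZeroDivisors_iff_right.mpr fun z hz => (map_eq_zero_iff _ e.injective).mp
      (mul_right_cancel₀ ha (by rw [← map_mul, hz, map_zero, zero_mul])))
    hg

/-- `Φ(u') ≠ 0` in `A[(c)/v_k]` (`u' ∉ (w)`, in particular `u' ≠ 0`). [folklore] -/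
theorem strictExc_equiv_chartGen_ne_zero (hc : IsQuasiRegular cc) [Nontrivial (A ⧸ II)] :
    Φ u' ≠ 0 := by
  intro h0
  apply strictExc_chartGen_notMem_span t v k hc
  rw [(map_eq_zero_iff _ (Φ).injective).mp h0]
  exact Ideal.zero_mem _

/-- **The pair `(u', g)` is weakly regular on the chart** when `φ(r) = wⁿ g` with `r ∉ (t)`
(`Φ(u') ≠ 0` in the domain `A[(c)/v_k]`, `C/(u')` a domain, `g ∉ (u')`).
[cite: Matsumura1987, Thm. 16.2 (i)] -/
theorem strictExc_isWeaklyRegular_pair [IsDomain A] (hc : IsQuasiRegular cc) [IsDomain (A ⧸ II)]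
    [IsDomain (A ⧸ Ideal.span {t})] (hvk : v k ∉ Ideal.span {t}) {g : C} {r : A} {n : ℕ}
    (h : ψ r = w ^ n * g) (hr : r ∉ Ideal.span {t}) :
    RingTheory.Sequence.IsWeaklyRegular C (List.ofFn (Fin.cons u' fun _ : Fin 1 => g)) := by
  haveI := strictExc_isDomain_quot t v k hc hvk
  haveI : IsDomain (Localization.Away (cc (Fin.succ k))) :=
    IsLocalization.isDomain_localization
      (powers_le_nonZeroDivisors_of_noZeroDivisors (strictExc_ne_zero t v k hvk))
  haveI : IsDomain RR := inferInstance
  exact isWeaklyRegular_pair_of_equiv (Φ) (strictExc_equiv_chartGen_ne_zero t v k hc)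
    (strictExc_notMem_of_chartBase_eq t v k hc hvk h hr)

/-- **Hence `(u', g)` is a quasi-regular pair on the chart.** [cite: Matsumura1987, Thm. 16.2 (i)] -/
theorem strictExc_isQuasiRegular_pair [IsDomain A] (hc : IsQuasiRegular cc) [IsDomain (A ⧸ II)]
    [IsDomain (A ⧸ Ideal.span {t})] (hvk : v k ∉ Ideal.span {t}) {g : C} {r : A} {n : ℕ}
    (h : ψ r = w ^ n * g) (hr : r ∉ Ideal.span {t}) :
    IsQuasiRegular (Fin.cons u' fun _ : Fin 1 => g : Fin 2 → C) :=
  isQuasiRegular_of_isWeaklyRegular _ (strictExc_isWeaklyRegular_pair t v k hc hvk h hr)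

end StrictExceptional

end ConeRung

end Summit.ResolutionOfSingularities.ResolutionOfSingularities.Theorems

end
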